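import Literature.AlgebraicGeometry.HodgeTheory.ConjugateComplexPoints
import HarnessLib

/-!
# Every embedding `ℚ̄ →+* ℂ` is an isomorphism onto the field of algebraic numbers `ℚ^al ⊂ ℂ`
# (Görtz–Wedhorn I, App. B, (B.18) and Prop. B.95: uniqueness of the algebraic closure)

Topic `Literature/AlgebraicGeometry/HodgeTheory` (family `hodge`), companion to `ConjugateComplexPoints.lean`
(`HodgeTheory.exists_apply_eq_of_isAlgebraic`: every algebraic complex number is in the image of any embedding
`σ : AlgebraicClosure ℚ →+* ℂ`; `HodgeTheory.algebraicClosure_le_fieldRange`). PROVED here (no named fact):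

* `isAlgClosed_algebraicClosure_rat_complex` / `isAlgClosed_toSubfield_algebraicClosure_rat_complex`: the subfield
  `ℚ^al := algebraicClosure ℚ ℂ` of algebraic numbers (and its `Subfield` copy, the carrier
  `IntermediateField.toSubfield (algebraicClosure ℚ ℂ)` used by `Summits/HodgeConjecture` for abelian varieties over
  `ℚ^al`) is algebraically closed (Mathlib `algebraicClosure.isAlgClosure`);
* `exists_ringEquiv_algebraicClosure_apply_eq` (and its `toSubfield` form
  `exists_ringEquiv_toSubfield_algebraicClosure_apply_eq`): every `σ : AlgebraicClosure ℚ →+* ℂ` factors as the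
  inclusion `ℚ^al ⊂ ℂ` after a ring ISOMORPHISM `σ̄ : AlgebraicClosure ℚ ≃+* ℚ^al` — Görtz–Wedhorn I, App. B (B.18)
  (*"`k^{alg} := {a ∈ K ; a is algebraic over k}` … called the algebraic closure of `k` in `K`"*) and Prop. B.95
  (*"An algebraic closure … of `k` is unique up to isomorphism of `k`-algebras"*, [BouAII] V 4.3 Thm. 2): the image
  of `σ` consists of algebraic numbers and contains all of them (`exists_apply_eq_of_isAlgebraic`).

Consumer: Ring 2 route `deform` (transport of a `ℚ̄`-fibre to the carrier `ℚ^al`; research route conditional on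
HC_CM; not a corollary; Q11.4-sentence-2 already refuted in dim ≥ 3). No junk values.
-/

noncomputable section

namespace Literature.AlgebraicGeometry.HodgeTheory

/-- The field of algebraic numbers `algebraicClosure ℚ ℂ ⊂ ℂ` is algebraically closed (it is an algebraic closure of
`ℚ`, Görtz–Wedhorn I Prop. B.95 / App. (B.18); Mathlib `algebraicClosure.isAlgClosure`).
[cite: GortzWedhorn2020, App. B Prop. B.95 and §(B.18)] -/
theorem isAlgClosed_algebraicClosure_rat_complex : IsAlgClosed (algebraicClosure ℚ ℂ) :=
  haveI h : IsAlgClosure ℚ (algebraicClosure ℚ ℂ) := algebraicClosure.isAlgClosure ℚ ℂ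
  h.isAlgClosed

/-- The same for the `Subfield` copy `(algebraicClosure ℚ ℂ).toSubfield` (the carrier `ℚ^al` of abelian varieties
over the algebraic numbers in `Summits/HodgeConjecture`). [cite: GortzWedhorn2020, App. B Prop. B.95 and §(B.18)] -/
theorem isAlgClosed_toSubfield_algebraicClosure_rat_complex : IsAlgClosed ((algebraicClosure ℚ ℂ).toSubfield) :=
  isAlgClosed_algebraicClosure_rat_complex

/-- **Every embedding `σ : ℚ̄ →+* ℂ` is an isomorphism onto the algebraic numbers**: there is a ring isomorphism
`σ̄ : AlgebraicClosure ℚ ≃+* algebraicClosure ℚ ℂ` with `(σ̄ a : ℂ) = σ a` (the image of `σ` is algebraic over `ℚ`,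
hence inside `algebraicClosure ℚ ℂ`, and contains every algebraic number by `exists_apply_eq_of_isAlgebraic`;
Görtz–Wedhorn I, App. B (B.18) and Prop. B.95, uniqueness of the algebraic closure up to isomorphism).
[cite: GortzWedhorn2020, App. B Prop. B.95 and §(B.18)] -/
theorem exists_ringEquiv_algebraicClosure_apply_eq (σ : AlgebraicClosure ℚ →+* ℂ) :
    ∃ σbar : AlgebraicClosure ℚ ≃+* algebraicClosure ℚ ℂ, ∀ a, ((σbar a : algebraicClosure ℚ ℂ) : ℂ) = σ a := by
  haveI : Algebra.IsAlgebraic ℚ (AlgebraicClosure ℚ) := AlgebraicClosure.isAlgebraic ℚ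
  have hmem : ∀ a, σ a ∈ algebraicClosure ℚ ℂ := fun a =>
    mem_algebraicClosure_iff.2 ((Algebra.IsAlgebraic.isAlgebraic (R := ℚ) a).algHom σ.toRatAlgHom)
  let σ' : AlgebraicClosure ℚ →+* algebraicClosure ℚ ℂ := σ.codRestrict _ hmem
  have hbij : Function.Bijective σ' := by
    refine ⟨σ'.injective, fun z => ?_⟩
    obtain ⟨w, hw⟩ := exists_apply_eq_of_isAlgebraic σ (mem_algebraicClosure_iff.1 z.2)
    exact ⟨w, Subtype.ext hw⟩
  exact ⟨RingEquiv.ofBijective σ' hbij, fun a => rfl⟩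

/-- The `Subfield` form, with the `algebraMap` of the carrier `ℚ^al = (algebraicClosure ℚ ℂ).toSubfield` to `ℂ`:
every `σ : ℚ̄ →+* ℂ` is `algebraMap ℚ^al ℂ ∘ σ̄` for a ring isomorphism `σ̄ : AlgebraicClosure ℚ ≃+* ℚ^al`, i.e.
`(algebraMap ℚ^al ℂ).comp σ̄ = σ`. [cite: GortzWedhorn2020, App. B Prop. B.95 and §(B.18)] -/
theorem exists_ringEquiv_toSubfield_algebraicClosure_apply_eq (σ : AlgebraicClosure ℚ →+* ℂ) :
    ∃ σbar : AlgebraicClosure ℚ ≃+* (algebraicClosure ℚ ℂ).toSubfield,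
      (algebraMap ((algebraicClosure ℚ ℂ).toSubfield) ℂ).comp σbar.toRingHom = σ := by
  obtain ⟨σbar, h⟩ := exists_ringEquiv_algebraicClosure_apply_eq σ
  exact ⟨σbar, RingHom.ext h⟩

end Literature.AlgebraicGeometry.HodgeTheory

end
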